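import Literature.Probability.Percolation.PositiveAssociationIntegral
import Mathlib.Probability.Kernel.Composition.MeasureCompProd
import HarnessLib

/-!
# Positive association is preserved by monotone associated kernels (Lindqvist 1988, Thm 4.1 / Cor 5.3)

Literature formalisation (topic `Literature/Probability/Percolation`; continues `PositiveAssociation.lean`,
`PositiveAssociationIntegral.lean`; no definitions, no named facts).

Lindqvist [Lindqvist1988, §4] calls a Markov kernel `k` from a partially ordered space `E₁` to a
partially ordered space `E₂` *monotone* if `x ≤ y ⇒ k(x, ·) ≤_st k(y, ·)` (here: `k x U ≤ k y U` for every
measurable increasing `U`) and *associated* if every `k(x, ·)` is an associated (= positively associated)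
probability measure.  **Theorem 4.1** ("if" part): if `P₁` is associated and `k` is monotone and associated
then the joint law `P₁ ⋆ k` of `(X₁, X₂)` on `E₁ × E₂` (coordinatewise order) is associated; **Corollary 5.3**:
a process whose initial law is associated and whose transition kernels are all monotone and associated is
associated — the special cases being Daley's (1968) stochastically monotone Markov chains on subsets of `ℝ`
(a kernel into a totally ordered space is automatically associated, [Lindqvist1988, Thm. 3.4]),
Harris's (1977) remark for monotone chains on `2^Z` with conditionally independent coordinates
([Lindqvist1988, Example 2]) and Barlow–Proschan's CIS sequences (tree:
`Literature.Combinatorics.Sahi2008.ConditionallyIncreasing.isPositivelyAssociated_of_isCIS`, finite binary case).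

* `IsPositivelyAssociated.compProd` — Lindqvist's Theorem 4.1 ("if"): `μ` positively associated on `α`,
  `κ : Kernel α β` a Markov kernel with `κ x` positively associated for every `x` and
  `x ≤ y ⇒ κ x U ≤ κ y U` for measurable upper sets `U` ⟹ `μ ⊗ₘ κ` is positively associated on `α × β`
  (Mathlib's componentwise product order).  Proof as printed: for increasing `A, B ⊆ α × β` the sections
  `A_x` are increasing in `β` and increase with `x`, so `x ↦ κ x A_x` is increasing; then
  `(μ⊗κ)(A ∩ B) = ∫ κ x (A_x ∩ B_x) ≥ ∫ κ x A_x · κ x B_x ≥ (∫ κ x A_x)(∫ κ x B_x)` by association of `κ x`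
  and the covariance form of the association of `μ` (`integral_mul_integral_le_integral_mul_of_unit`).
  Iterating gives Cor. 5.3 for any finite number of steps (`(μ ⊗ₘ κ₁) ⊗ₘ κ₂ …`).
* `isPositivelyAssociated_compProd_of_linearOrder` — the Daley case: into a *linearly* ordered `β` only
  monotonicity of the kernel is needed [Lindqvist1988, Thm. 3.4 + Thm. 4.1; Daley 1968].

## References
* [Lindqvist1988] B. H. Lindqvist, Association of probability measures on partially ordered spaces,
  J. Multivariate Anal. 26 (1988) 111–132 — Thm. 3.4, §4 (monotone / associated kernels), Thm. 4.1,
  Cor. 5.3, Examples 2–3.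
* [Daley1968] D. J. Daley, Stochastically monotone Markov chains, Z. Wahrsch. verw. Geb. 10 (1968) 305–317.
-/

noncomputable section

open MeasureTheory Measure Set Filter Topology ProbabilityTheory
open scoped ENNReal

namespace Literature.Probability.Percolation

variable {α β : Type*} [Preorder α] [Preorder β]

/-- Sections of an increasing subset of a product (componentwise order) are increasing. [folklore] -/
private theorem isUpperSet_section {S : Set (α × β)} (hS : IsUpperSet S) (x : α) :
    IsUpperSet (Prod.mk x ⁻¹' S) := fun _ _ hbb' hb => hS (Prod.mk_le_mk.2 ⟨le_rfl, hbb'⟩) hb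

/-- Sections of an increasing subset of a product increase with the base point. [folklore] -/
private theorem section_mono {S : Set (α × β)} (hS : IsUpperSet S) {x y : α} (hxy : x ≤ y) :
    Prod.mk x ⁻¹' S ⊆ Prod.mk y ⁻¹' S := fun _ hb => hS (Prod.mk_le_mk.2 ⟨hxy, le_rfl⟩) hb

variable [MeasurableSpace α] [MeasurableSpace β]

/-- **Lindqvist's Theorem 4.1 (monotone associated kernels preserve association).**  Let `μ` be a
positively associated probability measure on a preordered space `α` and `κ` a Markov kernel from `α` to a
preordered space `β` which is *associated* (`κ x` positively associated for every `x`) and *monotone*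
(`κ x U ≤ κ y U` for `x ≤ y` and every measurable increasing `U`).  Then the joint law `μ ⊗ₘ κ` on
`α × β` (componentwise order) is positively associated.  Iterating (`(μ ⊗ₘ κ₁) ⊗ₘ κ₂`, …) gives
Lindqvist's Corollary 5.3 for finitely many steps of a process with monotone associated transition kernels.
[cite: Lindqvist1988, Thm. 4.1 and Cor. 5.3] -/
theorem IsPositivelyAssociated.compProd {μ : Measure α} [IsProbabilityMeasure μ]
    (hμ : IsPositivelyAssociated μ) {κ : Kernel α β} [IsMarkovKernel κ]
    (hκa : ∀ x, IsPositivelyAssociated (κ x))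
    (hκm : ∀ ⦃x y : α⦄, x ≤ y → ∀ U : Set β, IsUpperSet U → MeasurableSet U → κ x U ≤ κ y U) :
    IsPositivelyAssociated (μ ⊗ₘ κ) := by
  refine isPositivelyAssociated_of_real fun A B hA hB hAm hBm => ?_
  -- the section functions `φ_S x = κ x S_x`, as real numbers in `[0,1]`
  let φ : Set (α × β) → α → ℝ := fun S x => (κ x).real (Prod.mk x ⁻¹' S)
  have hφm : ∀ {S : Set (α × β)}, MeasurableSet S → Measurable (φ S) := fun hS =>
    (Kernel.measurable_kernel_prodMk_left hS).ennreal_toReal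
  have hφ0 : ∀ (S : Set (α × β)) x, 0 ≤ φ S x := fun S x => measureReal_nonneg
  have hφ1 : ∀ (S : Set (α × β)) x, φ S x ≤ 1 := fun S x => measureReal_le_one
  have hφmono : ∀ {S : Set (α × β)}, IsUpperSet S → MeasurableSet S → Monotone (φ S) := by
    intro S hS hSm x y hxy
    have h1 : κ x (Prod.mk x ⁻¹' S) ≤ κ x (Prod.mk y ⁻¹' S) := measure_mono (section_mono hS hxy)
    have h2 : κ x (Prod.mk y ⁻¹' S) ≤ κ y (Prod.mk y ⁻¹' S) :=
      hκm hxy _ (isUpperSet_section hS y) (measurable_prodMk_left hSm)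
    exact ENNReal.toReal_mono (measure_ne_top _ _) (h1.trans h2)
  -- `(μ ⊗ₘ κ).real S = ∫ φ_S dμ`
  have hreal : ∀ {S : Set (α × β)}, MeasurableSet S → (μ ⊗ₘ κ).real S = ∫ x, φ S x ∂μ := by
    intro S hS
    rw [measureReal_def, Measure.compProd_apply hS, ← integral_toReal
      (Kernel.measurable_kernel_prodMk_left hS).aemeasurable
      (Eventually.of_forall fun x => measure_lt_top _ _)]
    rfl
  rw [hreal hAm, hreal hBm, hreal (hAm.inter hBm)]
  -- Step 1: association of `μ` in covariance form for the increasing `[0,1]`-valued `φ_A`, `φ_B`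
  have step1 : (∫ x, φ A x ∂μ) * (∫ x, φ B x ∂μ) ≤ ∫ x, φ A x * φ B x ∂μ :=
    hμ.integral_mul_integral_le_integral_mul_of_unit (hφmono hA hAm) (hφmono hB hBm) (hφm hAm)
      (hφm hBm) (hφ0 A) (hφ1 A) (hφ0 B) (hφ1 B)
  -- Step 2: association of each `κ x` on the sections
  have step2 : ∫ x, φ A x * φ B x ∂μ ≤ ∫ x, φ (A ∩ B) x ∂μ := by
    refine integral_mono_of_nonneg (Eventually.of_forall fun x => mul_nonneg (hφ0 A x) (hφ0 B x))
      ?_ (Eventually.of_forall fun x => ?_)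
    · exact (integrable_const (1 : ℝ)).mono' (hφm (hAm.inter hBm)).aestronglyMeasurable
        (Eventually.of_forall fun x => by
          rw [Real.norm_eq_abs, abs_of_nonneg (hφ0 _ x)]; exact hφ1 _ x)
    · have key := (hκa x).real (isUpperSet_section hA x) (isUpperSet_section hB x)
        (measurable_prodMk_left hAm) (measurable_prodMk_left hBm)
      simpa [φ, Set.preimage_inter] using key
  exact step1.trans step2

/-- **Stochastically monotone kernels into a chain (Daley 1968 / Lindqvist Thm 3.4 + Thm 4.1).**  If `β`
is *linearly* ordered, every probability measure on `β` is positively associated (two increasing sets are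
nested), so a monotone Markov kernel into `β` preserves positive association: `μ ⊗ₘ κ` is positively
associated whenever `μ` is and `κ x U ≤ κ y U` for `x ≤ y`, `U` measurable increasing — the discrete-time,
one-step form of Daley's theorem that stochastically monotone Markov chains started from an associated law
are associated. [cite: Lindqvist1988, Thm. 3.4 and Cor. 5.3 ("Daley [9] stated … the special case")] -/
theorem isPositivelyAssociated_compProd_of_linearOrder {β : Type*} [MeasurableSpace β] [LinearOrder β]
    {μ : Measure α} [IsProbabilityMeasure μ] (hμ : IsPositivelyAssociated μ) {κ : Kernel α β}
    [IsMarkovKernel κ]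
    (hκm : ∀ ⦃x y : α⦄, x ≤ y → ∀ U : Set β, IsUpperSet U → MeasurableSet U → κ x U ≤ κ y U) :
    IsPositivelyAssociated (μ ⊗ₘ κ) := by
  refine hμ.compProd (fun x => ?_) hκm
  -- on a chain two upper sets are nested, so every measure is positively associated
  intro U V hU hV _ _
  rcases hU.total hV with hUV | hVU
  · rw [inter_eq_self_of_subset_left hUV]
    exact (mul_le_mul' le_rfl prob_le_one).trans_eq (mul_one _)
  · rw [inter_eq_self_of_subset_right hVU]
    exact (mul_le_mul' prob_le_one le_rfl).trans_eq (one_mul _)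

end Literature.Probability.Percolation
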